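import Summits.ABC.ABC.Theorems.DefiniteXiSteinbergCoreThesisCalibration
import Summits.ABC.ABC.Theorems.DefiniteXiXiStrongBoundItemsCalibration
import HarnessLib

/-!
# Crux `SteinbergCore` (stmt-ABC-15024), line `p6_tamagawa_split` — the thesis calibration over ROUTE
# ITEMS: `SteinbergCore ⟺ FreyDegreeBound` with Pasten's Lemma 6.8 taken as the r9 item
# `IsogenyValuationTransport`

The landed calibration `Theorems/DefiniteXiSteinbergCoreThesisCalibration.lean` (lead c2, p160000) takes the
XL-apex Literature fact `PastenShimura2024_lemma_6_8` as the binder `h68`.  Route-choice 48123de3 (planner,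
2026-08-17T12:49Z) PROMOTED: that fact IS the route's crux r9 `IsogenyValuationTransport` (stmt-ABC-18928,
verbatim — `DefiniteXiXiStrongBoundItemsCalibration.isogenyValuationTransport_iff` is `Iff.rfl`), so the
calibration of stmt-ABC-15024 should cite the ITEM.  The tree being append-only, the rewiring is this new file
(lead c3): the two theorems of p160000 with `h68` replaced by `hIVT : IsogenyValuationTransport`, in section
form (`…_of_items'`) and with fully written headers (`…_of_items`, registered on the item).  Remaining
hypotheses that are neither route items nor proved: Takahashi 2001 Thm. 2.3 for the Shimura curves `X₀^D(M)` on
the level side (`hTlev`) and the discriminant side (`hT2`) and Jacquet–Langlands data (`hJL`) — the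
`∀`-`N⁻` debt of the crux, absent from its prime rung (`Theorems/DefiniteXiSteinbergCorePrimeRung.lean`,
p162616: there the calibration needs only `takahashi2001_thm_2_3_of_coprime`).

References: [Takahashi2001] Thm. 2.3 (p. 79), Thm. 3.2 (a) (p. 82); [PastenShimura2024] §3 p. 13, Lemma 6.8
(p. 22), §6.9 (p. 25); [Masser1990] (exponent 2 sharp).
-/

-- `Summit.<Summit>.<Problem>` is the mandated summit-side namespace (CONVENTIONS §2); for the single-conjunct
-- summit `ABC` the two coincide, so the duplicate `ABC.ABC` is deliberate.
set_option linter.dupNamespace false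

noncomputable section

namespace Summit.ABC.ABC.Theorems.SteinbergCoreThesisCalibrationItems

open Literature.NumberTheory.EllipticCurves Literature.NumberTheory.EllipticCurves.ModularForms
open Literature.NumberTheory.Automorphic
open Summit.ABC.ABC.Theses.DefiniteXi
open Summit.ABC.ABC.Theorems.DefiniteXiXiStrongBoundItemsCalibration (isogenyValuationTransport_iff)

section Takahashi

variable
  (hTlev : ∀ {N D M p m : ℕ}, p.Prime → M = p * m → ¬ p ∣ m → IsAdmissibleFactorization N D M →
    ∀ (X : ShimuraCurveData D M) (W : WeierstrassCurve ℚ) [W.IsElliptic], W.conductorNorm ℤ = N →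
    ∀ (W' : WeierstrassCurve ℚ) [W'.IsElliptic] (P : ShimuraParametrizationData X W'),
      P.IsMinimalFor W →
    ∀ S : Brandt.XiSetup m (D * p),
      ∃ i j : ℕ, 0 < i ∧ i * j = (W'.minimalDiscriminantNorm ℤ).factorization p ∧
        i ∣ S.xi (fun n => W'.LFunction n) ∧ P.deg * i = S.xi (fun n => W'.LFunction n) * j)
  (hT2 : ∀ {N D M p d : ℕ}, p.Prime → D = p * d → IsAdmissibleFactorization N D M →
    ∀ (X : ShimuraCurveData D M) (W : WeierstrassCurve ℚ) [W.IsElliptic], W.conductorNorm ℤ = N →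
    ∀ (W' : WeierstrassCurve ℚ) [W'.IsElliptic] (P : ShimuraParametrizationData X W'),
      P.IsMinimalFor W →
    ∀ S : Brandt.XiSetup (p * M) d,
      ∃ i j : ℕ, 0 < i ∧ i * j = (W'.minimalDiscriminantNorm ℤ).factorization p ∧
        i ∣ S.xi (fun n => W'.LFunction n) ∧ P.deg * i = S.xi (fun n => W'.LFunction n) * j)
  (hIVT : IsogenyValuationTransport) (hJL : nonempty_shimuraParametrizationData)

include hTlev hT2 hIVT hJL

/-- **`FreyDegreeBound ⟹ SteinbergCore` over items** (section form): p160000's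
`steinbergCore_of_freyDegreeBound_of_takahashi` with Pasten's Lemma 6.8 supplied by the r9 item
`IsogenyValuationTransport` (definitionally the same statement).
[cite: Takahashi2001, Thm. 2.3 (p. 79), Thm. 3.2 (a) (p. 82)] [cite: PastenShimura2024, Lemma 6.8 p. 22, §6.9 p. 25] -/
theorem steinbergCore_of_freyDegreeBound_of_items' (hX : FreyDegreeBound) : SteinbergCore :=
  steinbergCore_of_freyDegreeBound_of_takahashi hTlev hT2 (isogenyValuationTransport_iff.mp hIVT) hJL hX

/-- **`SteinbergCore ⟺ FreyDegreeBound` over items** (section form): modulo `hTlev`, `hT2`, Jacquet–Langlands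
data and the route items `IsogenyValuationTransport` (r9), `EisensteinQuarantine` (r5, abc-free binder),
`DefiniteRTControlPrime` (r3), `FreyModularity` (r9) — p160000's `steinbergCore_iff_freyDegreeBound_of_takahashi`
rewired. [cite: Takahashi2001, Thm. 2.3 (p. 79), Thm. 3.2 (a) (p. 82)] [cite: PastenShimura2024, Lemma 6.8 p. 22, §6.9 p. 25] -/
theorem steinbergCore_iff_freyDegreeBound_of_items' (hEis : EisensteinQuarantine) (hRT : DefiniteRTControlPrime)
    (hMod : FreyModularity) : SteinbergCore ↔ FreyDegreeBound :=
  steinbergCore_iff_freyDegreeBound_of_takahashi hTlev hT2 (isogenyValuationTransport_iff.mp hIVT) hJL hEis hRT hMod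

end Takahashi

/-- **`FreyDegreeBound ⟹ SteinbergCore` over items** — header fully written out (registered on stmt-ABC-15024).
[cite: Takahashi2001, Thm. 2.3 (p. 79), Thm. 3.2 (a) (p. 82)] [cite: PastenShimura2024, Lemma 6.8 p. 22, §6.9 p. 25] -/
theorem steinbergCore_of_freyDegreeBound_of_items : (∀ {N D M p m : ℕ}, p.Prime → M = p * m → ¬ p ∣ m → Literature.NumberTheory.Automorphic.IsAdmissibleFactorization N D M → ∀ (X : Literature.NumberTheory.Automorphic.ShimuraCurveData D M) (W : WeierstrassCurve ℚ) [W.IsElliptic], W.conductorNorm ℤ = N → ∀ (W' : WeierstrassCurve ℚ) [W'.IsElliptic] (P : Literature.NumberTheory.Automorphic.ShimuraParametrizationData X W'), P.IsMinimalFor W → ∀ S : Literature.NumberTheory.Automorphic.Brandt.XiSetup m (D * p), ∃ i j : ℕ, 0 < i ∧ i * j = (W'.minimalDiscriminantNorm ℤ).factorization p ∧ i ∣ S.xi (fun n => W'.LFunction n) ∧ P.deg * i = S.xi (fun n => W'.LFunction n) * j) → (∀ {N D M p d : ℕ}, p.Prime → D = p * d → Literature.NumberTheory.Automorphic.IsAdmissibleFactorization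 N D M → ∀ (X : Literature.NumberTheory.Automorphic.ShimuraCurveData D M) (W : WeierstrassCurve ℚ) [W.IsElliptic], W.conductorNorm ℤ = N → ∀ (W' : WeierstrassCurve ℚ) [W'.IsElliptic] (P : Literature.NumberTheory.Automorphic.ShimuraParametrizationData X W'), P.IsMinimalFor W → ∀ S : Literature.NumberTheory.Automorphic.Brandt.XiSetup (p * M) d, ∃ i j : ℕ, 0 < i ∧ i * j = (W'.minimalDiscriminantNorm ℤ).factorization p ∧ i ∣ S.xi (fun n => W'.LFunction n) ∧ P.deg * i = S.xi (fun n => W'.LFunction n) * j) → Summit.ABC.ABC.Theses.DefiniteXi.IsogenyValuationTransport → Literature.NumberTheory.Automorphic.nonempty_shimuraParametrizationData → Summit.ABC.ABC.Theses.DefiniteXi.FreyDegreeBound → Summit.ABC.ABC.Theses.DefiniteXi.SteinbergCore :=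
  fun hTlev hT2 hIVT hJL hX => steinbergCore_of_freyDegreeBound_of_items' hTlev hT2 hIVT hJL hX

/-- **`SteinbergCore ⟺ FreyDegreeBound` over items** — header fully written out (registered on stmt-ABC-15024):
relative to the route's own bets the crux is EXACTLY thesis-strength, and every hypothesis is now a route item
except Takahashi's theorem for Shimura curves (`hTlev`, `hT2`) and Jacquet–Langlands data.
[cite: Takahashi2001, Thm. 2.3 (p. 79), Thm. 3.2 (a) (p. 82)] [cite: PastenShimura2024, Lemma 6.8 p. 22, §6.9 p. 25] -/
theorem steinbergCore_iff_freyDegreeBound_of_items : (∀ {N D M p m : ℕ}, p.Prime → M = p * m → ¬ p ∣ m → Literature.NumberTheory.Automorphic.IsAdmissibleFactorization N D M → ∀ (X : Literature.NumberTheory.Automorphic.ShimuraCurveData D M) (W : WeierstrassCurve ℚ) [W.IsElliptic], W.conductorNorm ℤ = N → ∀ (W' : WeierstrassCurve ℚ) [W'.IsElliptic] (P : Literature.NumberTheory.Automorphic.ShimuraParametrizationData X W'), P.IsMinimalFor W → ∀ S : Literature.NumberTheory.Automorphic.Brandt.XiSetup m (D * p), ∃ i j : ℕ, 0 < i ∧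 i * j = (W'.minimalDiscriminantNorm ℤ).factorization p ∧ i ∣ S.xi (fun n => W'.LFunction n) ∧ P.deg * i = S.xi (fun n => W'.LFunction n) * j) → (∀ {N D M p d : ℕ}, p.Prime → D = p * d → Literature.NumberTheory.Automorphic.IsAdmissibleFactorization N D M → ∀ (X : Literature.NumberTheory.Automorphic.ShimuraCurveData D M) (W : WeierstrassCurve ℚ) [W.IsElliptic], W.conductorNorm ℤ = N → ∀ (W' : WeierstrassCurve ℚ) [W'.IsElliptic] (P : Literature.NumberTheory.Automorphic.ShimuraParametrizationData X W'), P.IsMinimalFor W → ∀ S : Literature.NumberTheory.Automorphic.Brandt.XiSetup (p * M) d, ∃ i j : ℕ, 0 < i ∧ i * j = (W'.minimalDiscriminantNorm ℤ).factorization p ∧ i ∣ S.xi (fun n => W'.LFunction n) ∧ P.deg * i = S.xi (fun n => W'.LFunction n) * j) → Summit.ABC.ABC.Theses.DefiniteXi.IsogenyValuationTransport → Literature.NumberTheory.Automorphic.nonempty_shimuraParametrizationData → Summit.ABC.ABC.Theses.DefiniteXi.EisensteinQuarantine → Summit.ABC.ABC.Theses.DefiniteXi.DefiniteRTControlPrime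 → Summit.ABC.ABC.Theses.DefiniteXi.FreyModularity → (Summit.ABC.ABC.Theses.DefiniteXi.SteinbergCore ↔ Summit.ABC.ABC.Theses.DefiniteXi.FreyDegreeBound) :=
  fun hTlev hT2 hIVT hJL hEis hRT hMod => steinbergCore_iff_freyDegreeBound_of_items' hTlev hT2 hIVT hJL hEis hRT hMod

end Summit.ABC.ABC.Theorems.SteinbergCoreThesisCalibrationItems

end
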